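import Literature.NumberTheory.GaloisRepresentations.AdZeroBlochKatoDatum
import Literature.NumberTheory.GaloisRepresentations.ProjectiveType
import Literature.NumberTheory.GaloisRepresentations.ResidualGaloisRep
import Literature.GroupTheory.SpecificGroups.PGL2DicksonCharP
import Literature.RepresentationTheory.Semisimple.SubrepresentationEquiv
import HarnessLib

/-!
# Route `RamifiedCoefficientSeed`, crux `AdjointLiftingGL3` (stmt-Langlands-16779), line `birth`:
# helpers for stub `stub_bigImageScalar` (S3) — irreducible `ad⁰` moves every point and every pair
# of `ℙ¹(k)`

Helper file (landed first) for the registered stub `stub_bigImageScalar` of the checked skeleton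
`Cruxes/AdjointLiftingGL3/Lines/birth.lean` (v4); its main theorem
`adZero_irreducible_moves_points_and_pairs` is registered as a sub-goal of the crux.  It supplies the
two geometric hypotheses `hfix`, `hpair` of the accepted Dickson theorem
`PGL2.pslTwo_le_conj_le_pglTwo_of_five_le` (`Literature/GroupTheory/SpecificGroups/PGL2DicksonCharP`)
for the projective image of a homomorphism `ρ : Γ → GL₂(k)` whose adjoint `Ad⁰ ∘ ρ : Γ → GL₃(k)`
(the fixed frame `glAdZeroTwoFrame` on `sl₂`, basis `(H, E, F) = (diag(1,-1), E₁₂, E₂₁)`) is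
irreducible on `k³`:

* `exists_mem_projectiveImage_smul_ne` — the projective image fixes no point of `ℙ¹(k)`: a common
  fixed point is a common eigenline; conjugated to `k e₁` (i.e. to `∞`), every `ρ(γ)` is upper
  triangular and `k·E ⊂ sl₂` is an `Ad`-stable line (`glAdZeroTwoFrame_mulVec_single_one`);
* `exists_mem_projectiveImage_not_smul_pair` — it stabilises no pair `{x, y}`: conjugated to
  `{∞, 0}`, every `ρ(γ)` is diagonal or antidiagonal and `k·H` is `Ad`-stable, `Ad(γ)H = ±H`
  (`glAdZeroTwoFrame_mulVec_single_zero_of_diag/antidiag`) — the sign character of a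
  dihedral-type image inside `ad⁰`.

Also: `isIrreducible_glRepresentation_conj` (irreducibility on `kⁿ` is conjugation invariant:
multiplication by `P` is an equivalence), and the
entries of an element of `GL₂(k)` fixing/swapping `∞` and `0` (Mathlib `OnePoint.smul_infty_eq_ite`,
`OnePoint.smul_some_eq_ite`).  Everything is elementary and fully proved. [folklore]
-/

set_option linter.dupNamespace false -- `Summit.Langlands.Langlands` is the mandated namespace

noncomputable section

namespace Summit.Langlands.Langlands.Cruxes.AdjointLiftingGL3.Birth

open scoped MatrixGroups OnePoint Pointwise Matrix
open Literature.NumberTheory.GaloisRepresentations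
open Literature.GroupTheory.SpecificGroups Literature.RepresentationTheory.Semisimple

/-! ### `Ad⁰` on special matrices: stable coordinate lines -/

section AdZeroColumns

variable {k : Type*} [Field k]

/-- For `P` and `P⁻¹` upper triangular, `Ad⁰(P)` maps the basis vector `E = E₁₂` (index `1` of
`adZeroTwoBasis`) to a multiple of itself: `k·E ⊂ sl₂` is stable under the Borel. [folklore] -/
theorem glAdZeroTwoFrame_mulVec_single_one {P : GL (Fin 2) k} (hP : P 1 0 = 0)
    (hQ : (P⁻¹ : GL (Fin 2) k) 1 0 = 0) :
    ((glAdZeroTwoFrame k P : GL (Fin 3) k) : Matrix (Fin 3) (Fin 3) k) *ᵥ Pi.single 1 1 =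
      (P 0 0 * (P⁻¹ : GL (Fin 2) k) 1 1) • (Pi.single 1 1 : Fin 3 → k) := by
  rw [coe_glAdZeroTwoFrame_apply, Matrix.mulVec_single_one]
  ext i
  fin_cases i <;> simp [adZeroTwoMatrixOf, hP, hQ]

/-- For `P`, `P⁻¹` diagonal, `Ad⁰(P)` maps `H = diag(1,-1)` (index `0` of `adZeroTwoBasis`) to
`(P₀₀ P⁻¹₀₀) · H`. [folklore] -/
theorem glAdZeroTwoFrame_mulVec_single_zero_of_diag {P : GL (Fin 2) k} (h10 : P 1 0 = 0)
    (h01 : P 0 1 = 0) (hQ10 : (P⁻¹ : GL (Fin 2) k) 1 0 = 0) (hQ01 : (P⁻¹ : GL (Fin 2) k) 0 1 = 0) :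
    ((glAdZeroTwoFrame k P : GL (Fin 3) k) : Matrix (Fin 3) (Fin 3) k) *ᵥ Pi.single 0 1 =
      (P 0 0 * (P⁻¹ : GL (Fin 2) k) 0 0) • (Pi.single 0 1 : Fin 3 → k) := by
  rw [coe_glAdZeroTwoFrame_apply, Matrix.mulVec_single_one]
  ext i
  fin_cases i <;> simp [adZeroTwoMatrixOf, h10, h01, hQ10, hQ01]

/-- For `P`, `P⁻¹` antidiagonal, `Ad⁰(P)` maps `H = diag(1,-1)` to `-(P₀₁ P⁻¹₁₀) · H`. [folklore] -/
theorem glAdZeroTwoFrame_mulVec_single_zero_of_antidiag {P : GL (Fin 2) k} (h00 : P 0 0 = 0)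
    (h11 : P 1 1 = 0) (hQ00 : (P⁻¹ : GL (Fin 2) k) 0 0 = 0) (hQ11 : (P⁻¹ : GL (Fin 2) k) 1 1 = 0) :
    ((glAdZeroTwoFrame k P : GL (Fin 3) k) : Matrix (Fin 3) (Fin 3) k) *ᵥ Pi.single 0 1 =
      (-(P 0 1 * (P⁻¹ : GL (Fin 2) k) 1 0)) • (Pi.single 0 1 : Fin 3 → k) := by
  rw [coe_glAdZeroTwoFrame_apply, Matrix.mulVec_single_one]
  ext i
  fin_cases i <;> simp [adZeroTwoMatrixOf, h00, h11, hQ00, hQ11]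

end AdZeroColumns

/-! ### Fixed points of `GL₂(k)` on `ℙ¹(k)`: entries -/

section Entries

variable {k : Type*} [Field k] [DecidableEq k]

/-- `g • ∞ = 0` forces `g₀₀ = 0`. [folklore] -/
theorem apply_zero_zero_eq_zero_of_smul_infty {g : GL (Fin 2) k}
    (h : g • (∞ : OnePoint k) = ((0 : k) : OnePoint k)) : g 0 0 = 0 := by
  rw [OnePoint.smul_infty_eq_ite] at h
  split_ifs at h with h10
  · exact absurd h (OnePoint.infty_ne_coe 0)
  · rw [OnePoint.coe_eq_coe, div_eq_zero_iff] at h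
    exact h.resolve_right h10

/-- `g • 0 = ∞` forces `g₁₁ = 0`. [folklore] -/
theorem apply_one_one_eq_zero_of_smul_zero {g : GL (Fin 2) k}
    (h : g • ((0 : k) : OnePoint k) = ∞) : g 1 1 = 0 := by
  rw [OnePoint.smul_some_eq_ite] at h
  split_ifs at h with h11
  · simpa using h11
  · exact absurd h (OnePoint.coe_ne_infty _)

/-- `g • ∞ = ∞` and `g • 0 = 0` force `g₀₁ = 0`. [folklore] -/
theorem apply_zero_one_eq_zero_of_smul_eq {g : GL (Fin 2) k}
    (h0 : g • ((0 : k) : OnePoint k) = ((0 : k) : OnePoint k)) : g 0 1 = 0 := by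
  rw [OnePoint.smul_some_eq_ite] at h0
  simp only [mul_zero, zero_add] at h0
  split_ifs at h0 with h11
  · exact absurd h0 (OnePoint.infty_ne_coe 0)
  · rw [OnePoint.coe_eq_coe, div_eq_zero_iff] at h0
    exact h0.resolve_right h11

end Entries

/-! ### Conjugation and irreducibility -/

section Conj

variable {Γ : Type*} [Group Γ] {k : Type*} [Field k] {n : ℕ}

/-- **Irreducibility of the representation on `kⁿ` is invariant under conjugation**: the
representation through `P σ P⁻¹` is equivalent to that through `σ` (multiplication by `P`; cf. the
same construction for crux `MuOrdinaryFamilyRT`), and irreducibility passes along equivalences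
(`Representation.isIrreducible_of_equiv`). [folklore] -/
theorem isIrreducible_glRepresentation_conj {σ : Γ →* GL (Fin n) k}
    (h : (glRepresentation σ).IsIrreducible) (P : GL (Fin n) k) :
    (glRepresentation ((MulAut.conj P).toMonoidHom.comp σ)).IsIrreducible := by
  haveI := h
  refine Representation.isIrreducible_of_equiv (ρ := glRepresentation σ)
    (Representation.Equiv.mk (Matrix.GeneralLinearGroup.toLin P).toLinearEquiv fun g => ?_)
  refine LinearMap.ext fun v => ?_
  simp only [LinearMap.comp_apply, MonoidHom.comp_apply, MulEquiv.coe_toMonoidHom,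
    MulAut.conj_apply, LinearEquiv.coe_coe]
  change (P : Matrix (Fin n) (Fin n) k) *ᵥ ((σ g : Matrix (Fin n) (Fin n) k) *ᵥ v) =
    ((P : Matrix (Fin n) (Fin n) k) * (σ g : Matrix (Fin n) (Fin n) k) *
      ((P⁻¹ : GL (Fin n) k) : Matrix (Fin n) (Fin n) k)) *ᵥ ((P : Matrix (Fin n) (Fin n) k) *ᵥ v)
  rw [Matrix.mulVec_mulVec, Matrix.mulVec_mulVec, Matrix.mul_assoc, Matrix.mul_assoc,
    Units.inv_mul, Matrix.mul_one]

/-- `Ad⁰` is a homomorphism: `Ad⁰ ∘ (T ρ T⁻¹) = Ad⁰(T) (Ad⁰ ∘ ρ) Ad⁰(T)⁻¹`. [folklore] -/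
theorem glAdZeroTwoFrame_comp_conj (ρ : Γ →* GL (Fin 2) k) (T : GL (Fin 2) k) :
    (glAdZeroTwoFrame k).comp ((MulAut.conj T).toMonoidHom.comp ρ) =
      (MulAut.conj (glAdZeroTwoFrame k T)).toMonoidHom.comp ((glAdZeroTwoFrame k).comp ρ) :=
  MonoidHom.ext fun γ => by simp [map_mul, map_inv]

end Conj

/-! ### Irreducible `ad⁰` ⇒ no fixed point and no stable pair on `ℙ¹(k)` -/

section StableConfigurations

variable {Γ : Type*} [Group Γ] {k : Type*} [Field k] [DecidableEq k]

/-- **No common fixed point on `ℙ¹`.** If `ad⁰ρ` (in the fixed frame `glAdZeroTwoFrame`) is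
irreducible on `k³`, the projective image of `ρ` fixes no point of `ℙ¹(k)`: a common fixed point is
a common eigenline `L`, and after conjugating `L` to `k e₁` every `ρ(γ)` is upper triangular, so the
line `k·E₁₂ ⊂ sl₂` is `Ad`-stable — a proper non-zero subrepresentation. [folklore] -/
theorem exists_mem_projectiveImage_smul_ne (ρ : Γ →* GL (Fin 2) k)
    (hirr : (glRepresentation ((glAdZeroTwoFrame k).comp ρ)).IsIrreducible) (x : OnePoint k) :
    ∃ h ∈ projectiveImage ρ, h • x ≠ x := by
  by_contra! hall
  obtain ⟨t, ht⟩ := PGL2.exists_smul_infty_eq x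
  obtain ⟨T, rfl⟩ := Matrix.ProjGenLinGroup.mk_surjective t
  rw [PGL2.mk_smul] at ht
  -- the conjugate `T⁻¹ ρ T` fixes `∞`, i.e. is upper triangular
  set ρT : Γ →* GL (Fin 2) k := (MulAut.conj T⁻¹).toMonoidHom.comp ρ with hρT
  have hρT_apply : ∀ γ, ρT γ = T⁻¹ * ρ γ * T := fun γ => by
    simp [hρT]
  have hfixT : ∀ γ, ρT γ • (∞ : OnePoint k) = ∞ := fun γ => by
    have h := hall _ (mk_apply_mem_projectiveImage ρ γ)
    rw [PGL2.mk_smul, ← ht] at h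
    rw [hρT_apply, mul_smul, mul_smul, inv_smul_eq_iff, h]
  have h10 : ∀ γ, (ρT γ) 1 0 = 0 := fun γ => OnePoint.smul_infty_eq_self_iff.mp (hfixT γ)
  have h10' : ∀ γ, ((ρT γ)⁻¹ : GL (Fin 2) k) 1 0 = 0 := fun γ => by
    rw [← map_inv]; exact h10 γ⁻¹
  -- irreducibility of `Ad ∘ ρT`
  have hirrT : (glRepresentation ((glAdZeroTwoFrame k).comp ρT)).IsIrreducible := by
    rw [hρT, glAdZeroTwoFrame_comp_conj]
    exact isIrreducible_glRepresentation_conj hirr _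
  -- the stable line `k · E`
  let S : Subrepresentation (glRepresentation ((glAdZeroTwoFrame k).comp ρT)) :=
    { toSubmodule := k ∙ (Pi.single 1 1 : Fin 3 → k)
      apply_mem_toSubmodule := by
        intro γ w hw
        obtain ⟨b, rfl⟩ := Submodule.mem_span_singleton.mp hw
        rw [glRepresentation_apply_apply, Matrix.mulVec_smul, MonoidHom.comp_apply,
          glAdZeroTwoFrame_mulVec_single_one (h10 γ) (h10' γ), smul_smul]
        exact Submodule.mem_span_singleton.mpr ⟨_, rfl⟩ }
  rcases hirrT.eq_bot_or_eq_top S with hS | hS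
  · have hmem : (Pi.single 1 1 : Fin 3 → k) ∈ S := Submodule.mem_span_singleton_self _
    rw [hS] at hmem
    have h0 : (Pi.single 1 1 : Fin 3 → k) = 0 := (Submodule.mem_bot k).mp hmem
    have h1 := congr_fun h0 1
    simp at h1
  · have htop : (k ∙ (Pi.single 1 1 : Fin 3 → k) : Submodule k (Fin 3 → k)) = ⊤ :=
      congrArg Subrepresentation.toSubmodule hS
    have hmem : (Pi.single 0 1 : Fin 3 → k) ∈ (k ∙ (Pi.single 1 1 : Fin 3 → k)) :=
      htop ▸ Submodule.mem_top
    obtain ⟨c, hc⟩ := Submodule.mem_span_singleton.mp hmem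
    have h1 := congr_fun hc 0
    simp at h1

/-- **No stable pair.** If `ad⁰ρ` is irreducible on `k³`, the projective image of `ρ` stabilises no
pair `{x, y} ⊂ ℙ¹(k)`, `x ≠ y`: otherwise, after conjugating `(x, y)` to `(∞, 0)`, every `ρ(γ)`
fixes or swaps `∞` and `0`, i.e. is diagonal or antidiagonal, and the line `k·H ⊂ sl₂`,
`H = diag(1,-1)`, is `Ad`-stable (`Ad(γ)H = ±H`): a proper non-zero subrepresentation (the sign
character of the dihedral-type image). [folklore] -/
theorem exists_mem_projectiveImage_not_smul_pair (ρ : Γ →* GL (Fin 2) k)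
    (hirr : (glRepresentation ((glAdZeroTwoFrame k).comp ρ)).IsIrreducible) (x y : OnePoint k)
    (hxy : x ≠ y) :
    ∃ h ∈ projectiveImage ρ, ¬ ((h • x = x ∨ h • x = y) ∧ (h • y = x ∨ h • y = y)) := by
  by_contra! hall
  -- move `(x, y)` to `(∞, 0)`
  obtain ⟨t₁, ht₁⟩ := PGL2.exists_smul_infty_eq x
  have hy₁ : t₁⁻¹ • y ≠ (∞ : OnePoint k) := fun h => hxy (by rw [← ht₁, ← h, smul_inv_smul])
  obtain ⟨c, hc⟩ := OnePoint.ne_infty_iff_exists.mp hy₁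
  obtain ⟨T, hT⟩ := Matrix.ProjGenLinGroup.mk_surjective (t₁ * PGL2.transl c)
  have htx : T • (∞ : OnePoint k) = x := by
    rw [← PGL2.mk_smul, hT, mul_smul, PGL2.transl_smul_infty, ht₁]
  have hty : T • ((0 : k) : OnePoint k) = y := by
    rw [← PGL2.mk_smul, hT, mul_smul, PGL2.transl_smul_coe, zero_add, hc, smul_inv_smul]
  -- the conjugate `T⁻¹ ρ T` fixes or swaps `∞` and `0`
  set ρT : Γ →* GL (Fin 2) k := (MulAut.conj T⁻¹).toMonoidHom.comp ρ with hρT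
  have hρT_apply : ∀ γ, ρT γ = T⁻¹ * ρ γ * T := fun γ => by
    simp [hρT]
  have hstab : ∀ γ,
      (ρT γ • (∞ : OnePoint k) = ∞ ∨ ρT γ • (∞ : OnePoint k) = ((0 : k) : OnePoint k)) ∧
        (ρT γ • ((0 : k) : OnePoint k) = ∞ ∨
          ρT γ • ((0 : k) : OnePoint k) = ((0 : k) : OnePoint k)) := fun γ => by
    have h := hall _ (mk_apply_mem_projectiveImage ρ γ)
    simp only [PGL2.mk_smul] at h
    simp only [hρT_apply, mul_smul, htx, hty, inv_smul_eq_iff]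
    exact h
  have hshape : ∀ γ,
      ((ρT γ) 1 0 = 0 ∧ (ρT γ) 0 1 = 0 ∧ ((ρT γ)⁻¹ : GL (Fin 2) k) 1 0 = 0 ∧
          ((ρT γ)⁻¹ : GL (Fin 2) k) 0 1 = 0) ∨
        ((ρT γ) 0 0 = 0 ∧ (ρT γ) 1 1 = 0 ∧ ((ρT γ)⁻¹ : GL (Fin 2) k) 0 0 = 0 ∧
          ((ρT γ)⁻¹ : GL (Fin 2) k) 1 1 = 0) := by
    intro γ
    obtain ⟨h1, h2⟩ := hstab γ
    rcases h1 with h1 | h1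
    · -- `ρT γ` fixes `∞`, hence fixes `0`; so does its inverse
      have h2' : ρT γ • ((0 : k) : OnePoint k) = ((0 : k) : OnePoint k) := by
        rcases h2 with h2 | h2
        · exact absurd (smul_left_cancel _ (h2.trans h1.symm)) (OnePoint.coe_ne_infty 0)
        · exact h2
      have hi1 : (ρT γ)⁻¹ • (∞ : OnePoint k) = ∞ := by rw [inv_smul_eq_iff, h1]
      have hi2 : (ρT γ)⁻¹ • ((0 : k) : OnePoint k) = ((0 : k) : OnePoint k) := by
        rw [inv_smul_eq_iff, h2']
      exact Or.inl ⟨OnePoint.smul_infty_eq_self_iff.mp h1, apply_zero_one_eq_zero_of_smul_eq h2',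
        OnePoint.smul_infty_eq_self_iff.mp hi1, apply_zero_one_eq_zero_of_smul_eq hi2⟩
    · -- `ρT γ` swaps `∞` and `0`; so does its inverse
      have h2' : ρT γ • ((0 : k) : OnePoint k) = ∞ := by
        rcases h2 with h2 | h2
        · exact h2
        · exact absurd (smul_left_cancel _ (h1.trans h2.symm)) (OnePoint.infty_ne_coe 0)
      have hi1 : (ρT γ)⁻¹ • ((0 : k) : OnePoint k) = ∞ := by rw [inv_smul_eq_iff, h1]
      have hi2 : (ρT γ)⁻¹ • (∞ : OnePoint k) = ((0 : k) : OnePoint k) := by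
        rw [inv_smul_eq_iff, h2']
      exact Or.inr ⟨apply_zero_zero_eq_zero_of_smul_infty h1,
        apply_one_one_eq_zero_of_smul_zero h2', apply_zero_zero_eq_zero_of_smul_infty hi2,
        apply_one_one_eq_zero_of_smul_zero hi1⟩
  have hcol : ∀ γ, ∃ a : k,
      ((glAdZeroTwoFrame k (ρT γ) : GL (Fin 3) k) : Matrix (Fin 3) (Fin 3) k) *ᵥ Pi.single 0 1 =
        a • (Pi.single 0 1 : Fin 3 → k) := fun γ => by
    rcases hshape γ with ⟨ha, hb, hc, hd⟩ | ⟨ha, hb, hc, hd⟩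
    · exact ⟨_, glAdZeroTwoFrame_mulVec_single_zero_of_diag ha hb hc hd⟩
    · exact ⟨_, glAdZeroTwoFrame_mulVec_single_zero_of_antidiag ha hb hc hd⟩
  -- irreducibility of `Ad ∘ ρT`
  have hirrT : (glRepresentation ((glAdZeroTwoFrame k).comp ρT)).IsIrreducible := by
    rw [hρT, glAdZeroTwoFrame_comp_conj]
    exact isIrreducible_glRepresentation_conj hirr _
  -- the stable line `k · H`
  let S : Subrepresentation (glRepresentation ((glAdZeroTwoFrame k).comp ρT)) :=
    { toSubmodule := k ∙ (Pi.single 0 1 : Fin 3 → k)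
      apply_mem_toSubmodule := by
        intro γ w hw
        obtain ⟨b, rfl⟩ := Submodule.mem_span_singleton.mp hw
        obtain ⟨a, ha⟩ := hcol γ
        rw [glRepresentation_apply_apply, Matrix.mulVec_smul, MonoidHom.comp_apply, ha, smul_smul]
        exact Submodule.mem_span_singleton.mpr ⟨_, rfl⟩ }
  rcases hirrT.eq_bot_or_eq_top S with hS | hS
  · have hmem : (Pi.single 0 1 : Fin 3 → k) ∈ S := Submodule.mem_span_singleton_self _
    rw [hS] at hmem
    have h0 : (Pi.single 0 1 : Fin 3 → k) = 0 := (Submodule.mem_bot k).mp hmem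
    have h1 := congr_fun h0 0
    simp at h1
  · have htop : (k ∙ (Pi.single 0 1 : Fin 3 → k) : Submodule k (Fin 3 → k)) = ⊤ :=
      congrArg Subrepresentation.toSubmodule hS
    have hmem : (Pi.single 1 1 : Fin 3 → k) ∈ (k ∙ (Pi.single 0 1 : Fin 3 → k)) :=
      htop ▸ Submodule.mem_top
    obtain ⟨c, hc⟩ := Submodule.mem_span_singleton.mp hmem
    have h1 := congr_fun hc 1
    simp at h1

end StableConfigurations

/-! ### Main theorem of this helper file (registered sub-goal) -/

/-- **Irreducible `ad⁰` moves every point and every pair of `ℙ¹(k)`** (the hypotheses `hfix`,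
`hpair` of the Dickson theorem `PGL2.pslTwo_le_conj_le_pglTwo_of_five_le` for the projective image
of `ρ`): if `Ad⁰ ∘ ρ` is irreducible on `k³`, the projective image of `ρ : Γ → GL₂(k)` fixes no point
of `ℙ¹(k)` and stabilises no pair `{x, y}`, `x ≠ y` (`exists_mem_projectiveImage_smul_ne`,
`exists_mem_projectiveImage_not_smul_pair`, universe-`0` packaging). [folklore] -/
theorem adZero_irreducible_moves_points_and_pairs :
    ∀ {Γ : Type} [Group Γ] {k : Type} [Field k] [DecidableEq k] (ρ : Γ →* GL (Fin 2) k),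
      (glRepresentation ((glAdZeroTwoFrame k).comp ρ)).IsIrreducible →
        (∀ x : OnePoint k, ∃ h ∈ projectiveImage ρ, h • x ≠ x) ∧
          ∀ x y : OnePoint k, x ≠ y →
            ∃ h ∈ projectiveImage ρ, ¬ ((h • x = x ∨ h • x = y) ∧ (h • y = x ∨ h • y = y)) := by
  intro Γ _ k _ _ ρ hirr
  exact ⟨exists_mem_projectiveImage_smul_ne ρ hirr, exists_mem_projectiveImage_not_smul_pair ρ hirr⟩

end Summit.Langlands.Langlands.Cruxes.AdjointLiftingGL3.Birth

end
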